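import Summits.AnomalousDissipation.AnomalousDissipation.Theorems.SawtoothPulseCascadeK1LocalisedCascadeTrapezoidTail

/-!
# K1loc, line `Spectral` / thin start — helper: THE LOG-TYPE `L¹` BOUND OF THE TRAPEZOID KERNEL (S-D constants)

Helper file of the prover lane on the crux `K1LocalisedCascade` (stmt-AnomalousDissipation-19491), route
`SawtoothPulseCascade` (S-D fibre ledger; the constants of the half-step, memo v9 §8–§9 lever (i)).  Same vocabulary as
`…TrapezoidFejer` / `…TrapezoidTail`: the trapezoid symbol `χ(m) = min(1, max(0, (L₂ − |m|)/D))`, `D = L₂ − L₁`, kernel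
`k_χ = (‖S_{L₂}‖² − ‖S_{L₁}‖²)/D`.  The mid-band symbols `ψ_n` of the fibre ledger are thin-ramp trapezoids (plateau `(1−β)λ`, zero at
`(1−β/2)λ`: `(L₁+L₂)/D ≈ (4 − 3β)/β ≈ 37` at `β = 0.1`, `≈ 20` for the `D = 0.09λ` ramp of memo v9 §9), for which the unit-mass bound
`(L₁+L₂)/D` of `…TrapezoidFejer` (`37`, `20`) and the Cauchy–Schwarz bound of `…AxisKernel` (`≈ 11`) are far from the truth
`(4/π²)·log((L₁+L₂)/D) + 0.99` (`2.45`, `2.18`; numerical quadrature).  Here: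
* §1 three pointwise facts: `1/sin²(πx) ≤ 1/(πx)² + 1` on `0 < |x| ≤ ½` (from `sin t ≥ t − t³/6`); the sup bound
  `|‖S_{L₂}‖² − ‖S_{L₁}‖²| ≤ L₂² − L₁²` (so `|k_χ| ≤ L₁ + L₂`); evenness `‖S_n(−s)‖ = ‖S_n(s)‖`; and, through the sine form of
  `…TrapezoidTail`, `|k_χ(x)| ≤ (|sin(πDx)|/D)·(1/(πx)² + 1)` for `0 < x ≤ ½`;
* §2 **`integral_norm_trapezoidKernel_le_log`**: `∫_T |k_χ| ≤ 4/π + (2/π)·log((L₁+L₂)/D) + 1/D + 1/(πD²)` — three zones on `[0, ½]`: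
  `|k| ≤ L₁+L₂` up to `1/(π(L₁+L₂))`, `|k| ≤ 1/(πx) + πx` up to `1/(πD)`, `|k| ≤ (1/(πx)² + 1)/D` beyond; evenness for `[−½, 0]`.
  Values: `3.18 + 1.1/D` at `(L₁+L₂)/D = 20`, `3.57 + …` at `37`, i.e. the `A`-socket `A ≥ ∫|k_ψ| + 2` of `…HalfStepV` is `≈ 5.2–5.6`
  instead of `13` (`A` enters the junk linearly with the envelope majorant of memo v9 §9);
* §3 the all-radii tail socket `∀ δ > 0, ∫_{δ≤‖s‖}|k_χ| ≤ (1/(2D))/δ` (hypothesis `hτ`, `τ = 1/(2D)`, of the modular half-step).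
(Averaging the oscillating factor `|sin(π(L₁+L₂)x)|` over its lobes would give the sharp coefficient `4/π²` instead of `2/π`; at the
ratios in use the gain is `≈ 0.3` and is not pursued.)  No definitions; no statement about the crux.
[cite: Grafakos2014, Prop. 3.1.2 (5), §3.1.3 (Dirichlet, Fejér and de la Vallée-Poussin kernels)] [problem: turb]
-/

-- `Summit.<Summit>.<Problem>`: single-conjunct summit, the duplicate namespace segment is deliberate.
set_option linter.dupNamespace false

noncomputable section

namespace Summit.AnomalousDissipation.AnomalousDissipation.Theorems.SawtoothPulseCascade.K1Window

open MeasureTheory Set Filter Topology Function Complex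
open scoped Real

/-! ## §1 Three pointwise facts -/

/-- `1/sin²(πx) ≤ 1/(πx)² + 1` for `0 < |x| ≤ ½` (from `sin t ≥ t − t³/6` and `(t² − 3)(t² − 8) ≥ 0` on `t² ≤ 3`).
[folklore] -/
theorem inv_sin_sq_le {x : ℝ} (hx0 : x ≠ 0) (hx : |x| ≤ 1 / 2) :
    1 / Real.sin (π * x) ^ 2 ≤ 1 / (π * x) ^ 2 + 1 := by
  -- reduce to `t = π|x| ∈ (0, π/2]`
  wlog hxpos : 0 < x generalizing x
  · have hneg : 0 < -x := by
      rcases lt_or_gt_of_ne hx0 with h | h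
      · linarith
      · exact absurd h (not_lt.mpr (le_of_not_gt hxpos))
    have h := this (neg_ne_zero.mpr hx0) (by rwa [abs_neg]) hneg
    simpa [mul_neg, Real.sin_neg, neg_sq, even_two] using h
  set t := π * x with ht
  have htpos : 0 < t := by positivity
  have hxle : x ≤ 1 / 2 := (le_abs_self x).trans hx
  have ht2 : t ^ 2 ≤ 3 := by
    have h1 : t ≤ π / 2 := by rw [ht]; nlinarith [Real.pi_pos]
    have h2 : π / 2 < 1.6 := by linarith [Real.pi_lt_d2]
    nlinarith
  have hcube : t - t ^ 3 / 6 ≤ Real.sin t := Real.sin_ge_sub_cube htpos.le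
  have hlow : 0 < t - t ^ 3 / 6 := by nlinarith
  have hsin0 : 0 < Real.sin t := hlow.trans_le hcube
  have hsq : (t - t ^ 3 / 6) ^ 2 ≤ Real.sin t ^ 2 := pow_le_pow_left₀ hlow.le hcube 2
  -- `1 ≤ (1/t² + 1)(t − t³/6)²` since `(t² − 3)(t² − 8) ≥ 0`
  have hpoly : 1 ≤ (1 / t ^ 2 + 1) * (t - t ^ 3 / 6) ^ 2 := by
    have ht0 : t ≠ 0 := htpos.ne'
    have e : (1 / t ^ 2 + 1) * (t - t ^ 3 / 6) ^ 2 = 1 + t ^ 2 * ((t ^ 2 - 3) * (t ^ 2 - 8)) / 36 := by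
      field_simp; ring
    rw [e]
    have : 0 ≤ (t ^ 2 - 3) * (t ^ 2 - 8) := mul_nonneg_of_nonpos_of_nonpos (by linarith) (by linarith)
    have : 0 ≤ t ^ 2 * ((t ^ 2 - 3) * (t ^ 2 - 8)) / 36 := by positivity
    linarith
  rw [div_le_iff₀ (pow_pos hsin0 2)]
  calc (1 : ℝ) ≤ (1 / t ^ 2 + 1) * (t - t ^ 3 / 6) ^ 2 := hpoly
    _ ≤ (1 / t ^ 2 + 1) * Real.sin t ^ 2 := mul_le_mul_of_nonneg_left hsq (by positivity)

/-- **Sup bound of the trapezoid kernel**: `|‖S_{L₂}(s)‖² − ‖S_{L₁}(s)‖²| ≤ L₂² − L₁²` for `L₁ ≤ L₂`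
(`S_{L₂} = S_{L₁} + R` with `‖R‖ ≤ L₂ − L₁`, `‖S_{L₁}‖ ≤ L₁`), i.e. `|k_χ| ≤ (L₂² − L₁²)/D = L₁ + L₂`. [folklore] -/
theorem abs_fejer_sub_fejer_le {L₁ L₂ : ℕ} (hL : L₁ ≤ L₂) (s : UnitAddCircle) :
    |‖∑ m ∈ Finset.range L₂, (fourier (-(m : ℤ)) s : ℂ)‖ ^ 2 - ‖∑ m ∈ Finset.range L₁, (fourier (-(m : ℤ)) s : ℂ)‖ ^ 2| ≤
      (L₂ : ℝ) ^ 2 - (L₁ : ℝ) ^ 2 := by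
  set S₁ : ℂ := ∑ m ∈ Finset.range L₁, (fourier (-(m : ℤ)) s : ℂ) with hS₁
  set R : ℂ := ∑ m ∈ Finset.Ico L₁ L₂, (fourier (-(m : ℤ)) s : ℂ) with hR
  have hsplit : ∑ m ∈ Finset.range L₂, (fourier (-(m : ℤ)) s : ℂ) = S₁ + R :=
    (Finset.sum_range_add_sum_Ico _ hL).symm
  have hone : ∀ m : ℕ, ‖(fourier (-(m : ℤ)) s : ℂ)‖ = 1 := fun m => Circle.norm_coe _
  have hS₁le : ‖S₁‖ ≤ L₁ := by
    refine (norm_sum_le _ _).trans ?_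
    rw [Finset.sum_congr rfl fun m _ => hone m, Finset.sum_const, Finset.card_range]; simp
  have hRle : ‖R‖ ≤ (L₂ : ℝ) - L₁ := by
    refine (norm_sum_le _ _).trans ?_
    rw [Finset.sum_congr rfl fun m _ => hone m, Finset.sum_const, Nat.card_Ico]
    simp [Nat.cast_sub hL]
  have hL' : (L₁ : ℝ) ≤ L₂ := by exact_mod_cast hL
  have h0S := norm_nonneg S₁
  have h0R := norm_nonneg R
  rw [hsplit]
  have hup : ‖S₁ + R‖ ≤ ‖S₁‖ + ‖R‖ := norm_add_le _ _
  have hdown : ‖S₁‖ - ‖R‖ ≤ ‖S₁ + R‖ := by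
    have := norm_sub_norm_le S₁ (S₁ + R)
    have e : S₁ - (S₁ + R) = -R := by ring
    rw [e, norm_neg] at this
    linarith [abs_le.mp (abs_norm_sub_norm_le S₁ (S₁ + R))]
  rw [abs_le]
  constructor
  · -- lower: `‖S₁‖² − ‖S₁+R‖² ≤ 2‖S₁‖‖R‖ ≤ 2 L₁ (L₂ − L₁) ≤ L₂² − L₁²`
    rcases le_or_gt ‖R‖ ‖S₁‖ with h | h
    · have h1 : (‖S₁‖ - ‖R‖) ^ 2 ≤ ‖S₁ + R‖ ^ 2 := pow_le_pow_left₀ (by linarith) hdown 2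
      nlinarith [mul_le_mul hS₁le hRle h0R (Nat.cast_nonneg L₁)]
    · have h1 : 0 ≤ ‖S₁ + R‖ ^ 2 := sq_nonneg _
      nlinarith [mul_le_mul hS₁le hRle h0R (Nat.cast_nonneg L₁)]
  · have h1 : ‖S₁ + R‖ ^ 2 ≤ (‖S₁‖ + ‖R‖) ^ 2 := pow_le_pow_left₀ (norm_nonneg _) hup 2
    nlinarith [mul_le_mul hS₁le hRle h0R (Nat.cast_nonneg L₁), pow_le_pow_left₀ h0R hRle 2]

/-- **Evenness**: `‖S_n(−s)‖ = ‖S_n(s)‖` (`e_{−m}(−s) = conj e_{−m}(s)`). [folklore] -/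
theorem norm_geomSum_neg (n : ℕ) (s : UnitAddCircle) :
    ‖∑ m ∈ Finset.range n, (fourier (-(m : ℤ)) (-s) : ℂ)‖ = ‖∑ m ∈ Finset.range n, (fourier (-(m : ℤ)) s : ℂ)‖ := by
  have h : ∀ m : ℕ, (fourier (-(m : ℤ)) (-s) : ℂ) = starRingEnd ℂ (fourier (-(m : ℤ)) s) := fun m => by
    rw [fourier_apply, smul_neg, fourier_neg']
  simp_rw [h, ← map_sum, RCLike.norm_conj]


/-- **Pointwise, through the sine form**: for `0 < x ≤ ½`,
`|k(x)| ≤ (|sin(πDx)|/D)·(1/(πx)² + 1)`, `k = (‖S_{L₂}‖² − ‖S_{L₁}‖²)/D`. [cite: Grafakos2014, §3.1.3] -/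
theorem abs_trapezoidKernel_coe_le_sin {L₁ L₂ : ℕ} (hL : L₁ < L₂) {x : ℝ} (hx0 : 0 < x) (hx : x ≤ 1 / 2) :
    |(‖∑ m ∈ Finset.range L₂, (fourier (-(m : ℤ)) (x : UnitAddCircle) : ℂ)‖ ^ 2 -
        ‖∑ m ∈ Finset.range L₁, (fourier (-(m : ℤ)) (x : UnitAddCircle) : ℂ)‖ ^ 2) / ((L₂ : ℝ) - L₁)| ≤
      |Real.sin (π * ((L₂ : ℝ) - L₁) * x)| / ((L₂ : ℝ) - L₁) * (1 / (π * x) ^ 2 + 1) := by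
  have hL' : (L₁ : ℝ) < L₂ := by exact_mod_cast hL
  have hD : (0 : ℝ) < (L₂ : ℝ) - L₁ := by linarith
  have hxabs : |x| ≤ 1 / 2 := abs_le.mpr ⟨by linarith, hx⟩
  have hsin := Literature.Analysis.FunctionSpaces.Torus.four_mul_sq_le_sin_sq hxabs
  have hs0 : 0 < Real.sin (π * x) ^ 2 := by nlinarith [sq_nonneg x, hx0]
  set k := (‖∑ m ∈ Finset.range L₂, (fourier (-(m : ℤ)) (x : UnitAddCircle) : ℂ)‖ ^ 2 -
      ‖∑ m ∈ Finset.range L₁, (fourier (-(m : ℤ)) (x : UnitAddCircle) : ℂ)‖ ^ 2) / ((L₂ : ℝ) - L₁) with hk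
  have hid := trapezoidKernel_coe_mul_sin_sq L₁ L₂ x
  rw [← hk] at hid
  -- `|k| sin² ≤ |sin(πDx)|/D`
  have h1 : |k| * Real.sin (π * x) ^ 2 ≤ |Real.sin (π * ((L₂ : ℝ) - L₁) * x)| / ((L₂ : ℝ) - L₁) := by
    have : |k| * Real.sin (π * x) ^ 2 =
        |Real.sin (π * (L₁ + L₂) * x)| * |Real.sin (π * ((L₂ : ℝ) - L₁) * x)| / ((L₂ : ℝ) - L₁) := by
      rw [← abs_of_pos hs0, ← abs_mul, hid, abs_div, abs_of_pos hD, abs_mul]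
    rw [this, div_le_div_iff_of_pos_right hD]
    exact mul_le_of_le_one_left (abs_nonneg _) (Real.abs_sin_le_one _)
  have h2 := inv_sin_sq_le hx0.ne' hxabs
  calc |k| = |k| * Real.sin (π * x) ^ 2 * (1 / Real.sin (π * x) ^ 2) := by
        rw [one_div, mul_inv_cancel_right₀ hs0.ne']
    _ ≤ |Real.sin (π * ((L₂ : ℝ) - L₁) * x)| / ((L₂ : ℝ) - L₁) * (1 / (π * x) ^ 2 + 1) :=
        mul_le_mul h1 h2 (by positivity) (by positivity)

section Trapezoid

variable {χ : ℤ → ℂ} {L₁ L₂ : ℕ}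

/-- **The half-interval bound**: `∫₀^{½} |k(x)| dx ≤ 2/π + (1/π)·log((L₁+L₂)/D) + 1/(2D) + 1/(2πD²)`
(three zones: `|k| ≤ L₁+L₂` on `[0, 1/(π(L₁+L₂))]`, `|k| ≤ 1/(πx) + πx` up to `1/(πD)`, `|k| ≤ (1/(πx)² + 1)/D` beyond).
[cite: Grafakos2014, §3.1.3] -/
theorem intervalIntegral_abs_trapezoidKernel_le (hL : L₁ < L₂) :
    ∫ x in (0 : ℝ)..(1 / 2),
      |(‖∑ m ∈ Finset.range L₂, (fourier (-(m : ℤ)) (x : UnitAddCircle) : ℂ)‖ ^ 2 -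
          ‖∑ m ∈ Finset.range L₁, (fourier (-(m : ℤ)) (x : UnitAddCircle) : ℂ)‖ ^ 2) / ((L₂ : ℝ) - L₁)| ≤
      2 / π + 1 / π * Real.log (((L₁ : ℝ) + L₂) / ((L₂ : ℝ) - L₁)) + 1 / (2 * ((L₂ : ℝ) - L₁)) +
        1 / (2 * π * ((L₂ : ℝ) - L₁) ^ 2) := by
  have hL' : (L₁ : ℝ) < L₂ := by exact_mod_cast hL
  have hD1 : (1 : ℝ) ≤ (L₂ : ℝ) - L₁ := by
    have : L₁ + 1 ≤ L₂ := hL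
    have := (Nat.cast_le (α := ℝ)).mpr this
    push_cast at this; linarith
  set D : ℝ := (L₂ : ℝ) - L₁ with hDdef
  set K : ℝ := (L₁ : ℝ) + L₂ with hKdef
  have hD : 0 < D := by linarith
  have hDK : D ≤ K := by simp only [hDdef, hKdef]; linarith [(Nat.cast_nonneg L₁ : (0 : ℝ) ≤ L₁)]
  have hK : 0 < K := hD.trans_le hDK
  have hπ := Real.pi_pos
  have hπ3 : 3 < π := Real.pi_gt_three
  set a : ℝ := 1 / (π * K) with ha
  set b : ℝ := 1 / (π * D) with hb
  have ha0 : 0 < a := by positivity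
  have hb0 : 0 < b := by positivity
  have hab : a ≤ b := one_div_le_one_div_of_le (by positivity) (mul_le_mul_of_nonneg_left hDK hπ.le)
  have hb2 : b ≤ 1 / 2 := by
    rw [hb, div_le_div_iff₀ (by positivity) (by norm_num : (0 : ℝ) < 2)]
    nlinarith
  set f : ℝ → ℝ := fun x => |(‖∑ m ∈ Finset.range L₂, (fourier (-(m : ℤ)) (x : UnitAddCircle) : ℂ)‖ ^ 2 -
      ‖∑ m ∈ Finset.range L₁, (fourier (-(m : ℤ)) (x : UnitAddCircle) : ℂ)‖ ^ 2) / ((L₂ : ℝ) - L₁)| with hf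
  have hfc : Continuous f := by
    have h2 := (continuous_fejer L₂).comp (AddCircle.continuous_mk' (1 : ℝ))
    have h1 := (continuous_fejer L₁).comp (AddCircle.continuous_mk' (1 : ℝ))
    exact ((h2.sub h1).div_const _).abs
  have hfi : ∀ u v : ℝ, IntervalIntegrable f volume u v := fun u v => hfc.intervalIntegrable u v
  -- zone A: `f ≤ K`
  have hA : ∫ x in (0 : ℝ)..a, f x ≤ ∫ x in (0 : ℝ)..a, K := by
    refine intervalIntegral.integral_mono_on ha0.le (hfi _ _) intervalIntegrable_const fun x _ => ?_
    simp only [hf]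
    rw [abs_div, abs_of_pos hD, div_le_iff₀ hD]
    have h := abs_fejer_sub_fejer_le hL.le (x : UnitAddCircle)
    have e : (L₂ : ℝ) ^ 2 - (L₁ : ℝ) ^ 2 = K * D := by simp only [hKdef, hDdef]; ring
    linarith
  have hAval : ∫ x in (0 : ℝ)..a, K = 1 / π := by
    rw [intervalIntegral.integral_const, smul_eq_mul, sub_zero, ha]
    field_simp
  -- zone B: `f ≤ 1/(πx) + πx`
  have hB : ∫ x in a..b, f x ≤ ∫ x in a..b, (1 / π * x⁻¹ + π * x) := by
    have hci : IntervalIntegrable (fun x : ℝ => 1 / π * x⁻¹ + π * x) volume a b := by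
      refine (ContinuousOn.intervalIntegrable ?_)
      refine ContinuousOn.add (continuousOn_const.mul (continuousOn_inv₀.mono fun x hx => ?_)) (by fun_prop)
      rw [uIcc_of_le hab] at hx
      exact (ha0.trans_le hx.1).ne'
    refine intervalIntegral.integral_mono_on hab (hfi _ _) hci fun x hx => ?_
    have hx0 : 0 < x := ha0.trans_le hx.1
    have hx2 : x ≤ 1 / 2 := hx.2.trans hb2
    refine (abs_trapezoidKernel_coe_le_sin hL hx0 hx2).trans ?_
    have hs : |Real.sin (π * ((L₂ : ℝ) - L₁) * x)| ≤ π * D * x := by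
      refine (Real.abs_sin_le_abs).trans_eq ?_
      rw [abs_of_nonneg (by positivity)]
    calc |Real.sin (π * ((L₂ : ℝ) - L₁) * x)| / ((L₂ : ℝ) - L₁) * (1 / (π * x) ^ 2 + 1)
        ≤ π * D * x / D * (1 / (π * x) ^ 2 + 1) :=
          mul_le_mul_of_nonneg_right (div_le_div_of_nonneg_right hs hD.le) (by positivity)
      _ = 1 / π * x⁻¹ + π * x := by field_simp
  have hlog : Real.log (b / a) = Real.log (K / D) := by
    congr 1
    rw [ha, hb]; field_simp
  have hIinv : IntervalIntegrable (fun x : ℝ => 1 / π * x⁻¹) volume a b :=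
    (continuousOn_const.mul (continuousOn_inv₀.mono fun x hx => by
      rw [uIcc_of_le hab] at hx; exact (ha0.trans_le hx.1).ne')).intervalIntegrable
  have hIlin : IntervalIntegrable (fun x : ℝ => π * x) volume a b :=
    (by fun_prop : Continuous fun x : ℝ => π * x).intervalIntegrable _ _
  have hBval : ∫ x in a..b, (1 / π * x⁻¹ + π * x) = 1 / π * Real.log (K / D) + π * ((b ^ 2 - a ^ 2) / 2) := by
    rw [intervalIntegral.integral_add hIinv hIlin, intervalIntegral.integral_const_mul,
      intervalIntegral.integral_const_mul, integral_inv_of_pos ha0 hb0, integral_id, hlog]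
  -- zone C: `f ≤ (1/(πx)² + 1)/D`
  have hC : ∫ x in b..(1 / 2 : ℝ), f x ≤ ∫ x in b..(1 / 2 : ℝ), (1 / (π ^ 2 * D) * (1 / x ^ 2) + 1 / D) := by
    have hci : IntervalIntegrable (fun x : ℝ => 1 / (π ^ 2 * D) * (1 / x ^ 2) + 1 / D) volume b (1 / 2) := by
      refine ContinuousOn.intervalIntegrable ?_
      refine ContinuousOn.add (continuousOn_const.mul (continuousOn_const.div (continuousOn_pow 2) fun x hx => ?_))
        continuousOn_const
      rw [uIcc_of_le hb2] at hx
      exact pow_ne_zero 2 (hb0.trans_le hx.1).ne'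
    refine intervalIntegral.integral_mono_on hb2 (hfi _ _) hci fun x hx => ?_
    have hx0 : 0 < x := hb0.trans_le hx.1
    refine (abs_trapezoidKernel_coe_le_sin hL hx0 hx.2).trans ?_
    calc |Real.sin (π * ((L₂ : ℝ) - L₁) * x)| / ((L₂ : ℝ) - L₁) * (1 / (π * x) ^ 2 + 1)
        ≤ 1 / D * (1 / (π * x) ^ 2 + 1) :=
          mul_le_mul_of_nonneg_right (div_le_div_of_nonneg_right (Real.abs_sin_le_one _) hD.le) (by positivity)
      _ = 1 / (π ^ 2 * D) * (1 / x ^ 2) + 1 / D := by field_simp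
  have hIsq : IntervalIntegrable (fun x : ℝ => 1 / (π ^ 2 * D) * (1 / x ^ 2)) volume b (1 / 2) :=
    (continuousOn_const.mul (continuousOn_const.div (continuousOn_pow 2) fun x hx => by
      rw [uIcc_of_le hb2] at hx; exact pow_ne_zero 2 (hb0.trans_le hx.1).ne')).intervalIntegrable
  have hIc : IntervalIntegrable (fun _ : ℝ => 1 / D) volume b (1 / 2) := intervalIntegrable_const
  have hCval : ∫ x in b..(1 / 2 : ℝ), (1 / (π ^ 2 * D) * (1 / x ^ 2) + 1 / D) =
      1 / (π ^ 2 * D) * (1 / b - 2) + (1 / 2 - b) * (1 / D) := by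
    rw [intervalIntegral.integral_add hIsq hIc, intervalIntegral.integral_const_mul, intervalIntegral_inv_sq hb0 hb2,
      intervalIntegral.integral_const, smul_eq_mul]
  -- assemble
  have hsplit : ∫ x in (0 : ℝ)..(1 / 2), f x = (∫ x in (0 : ℝ)..a, f x) + ((∫ x in a..b, f x) + ∫ x in b..(1 / 2 : ℝ), f x) := by
    rw [intervalIntegral.integral_add_adjacent_intervals (hfi _ _) (hfi _ _),
      intervalIntegral.integral_add_adjacent_intervals (hfi _ _) (hfi _ _)]
  rw [hsplit]
  have hb1 : 1 / b = π * D := by rw [hb, one_div_one_div]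
  have hbsq : b ^ 2 = 1 / (π ^ 2 * D ^ 2) := by rw [hb]; field_simp
  have htot : (1 / π) + ((1 / π * Real.log (K / D) + π * ((b ^ 2 - a ^ 2) / 2)) +
      (1 / (π ^ 2 * D) * (1 / b - 2) + (1 / 2 - b) * (1 / D))) ≤
      2 / π + 1 / π * Real.log (K / D) + 1 / (2 * D) + 1 / (2 * π * D ^ 2) := by
    rw [hb1, hbsq]
    have h1 : π * ((1 / (π ^ 2 * D ^ 2) - a ^ 2) / 2) ≤ 1 / (2 * π * D ^ 2) := by
      have : π * ((1 / (π ^ 2 * D ^ 2)) / 2) = 1 / (2 * π * D ^ 2) := by field_simp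
      nlinarith [sq_nonneg a]
    have h2 : 1 / (π ^ 2 * D) * (π * D - 2) ≤ 1 / π := by
      rw [div_mul_eq_mul_div, one_mul, div_le_div_iff₀ (by positivity) hπ]
      nlinarith
    have h3 : (1 / 2 - b) * (1 / D) ≤ 1 / (2 * D) := by
      calc (1 / 2 - b) * (1 / D) ≤ 1 / 2 * (1 / D) := mul_le_mul_of_nonneg_right (by linarith) (by positivity)
        _ = 1 / (2 * D) := one_div_mul_one_div 2 D
    have hsum := add_le_add (add_le_add h1 h2) h3
    have e : 2 / π + 1 / π * Real.log (K / D) + 1 / (2 * D) + 1 / (2 * π * D ^ 2) =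
        1 / π + 1 / π * Real.log (K / D) + (1 / (2 * π * D ^ 2) + 1 / π + 1 / (2 * D)) := by ring
    rw [e]
    linarith [hsum]
  calc (∫ x in (0 : ℝ)..a, f x) + ((∫ x in a..b, f x) + ∫ x in b..(1 / 2 : ℝ), f x)
      ≤ (∫ x in (0 : ℝ)..a, K) + ((∫ x in a..b, (1 / π * x⁻¹ + π * x)) +
          ∫ x in b..(1 / 2 : ℝ), (1 / (π ^ 2 * D) * (1 / x ^ 2) + 1 / D)) := add_le_add hA (add_le_add hB hC)
    _ = (1 / π) + ((1 / π * Real.log (K / D) + π * ((b ^ 2 - a ^ 2) / 2)) +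
          (1 / (π ^ 2 * D) * (1 / b - 2) + (1 / 2 - b) * (1 / D))) := by rw [hAval, hBval, hCval]
    _ ≤ _ := htot

/-- **Log-type `L¹` bound of the trapezoid kernel**: with `K = L₁ + L₂`, `D = L₂ − L₁`,
`∫_T |k_χ| ≤ 4/π + (2/π)·log(K/D) + 1/D + 1/(πD²)` — `≈ 3.2` at `K/D = 20`, `≈ 3.6` at `37` (true value
`(4/π²)log(K/D) + 0.99`; `(L₁+L₂)/D = 20`, `37` by `…TrapezoidFejer.integral_norm_trapezoidKernel_le_ratio`).  This is the `A`-socket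
(`A ≥ ∫|k_ψ| + 2`) of `…HalfStepV.sum_window_sq_norm_vstep_le` for thin-ramp mid-band symbols. [cite: Grafakos2014, §3.1.3] -/
theorem integral_norm_trapezoidKernel_le_log (hL : L₁ < L₂)
    (hχ : ∀ m : ℤ, χ m = ((min 1 (max 0 (((L₂ : ℝ) - |(m : ℝ)|) / ((L₂ : ℝ) - L₁))) : ℝ) : ℂ)) :
    ∫ s : UnitAddCircle, ‖∑ m ∈ Finset.Icc (-(L₂ : ℤ)) L₂, χ m * fourier (-m) s‖ ≤
      4 / π + 2 / π * Real.log (((L₁ : ℝ) + L₂) / ((L₂ : ℝ) - L₁)) + 1 / ((L₂ : ℝ) - L₁) +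
        1 / (π * ((L₂ : ℝ) - L₁) ^ 2) := by
  simp_rw [trapezoidKernel_eq hL hχ, Complex.norm_real, Real.norm_eq_abs]
  set F : UnitAddCircle → ℝ := fun s => |(‖∑ m ∈ Finset.range L₂, (fourier (-(m : ℤ)) s : ℂ)‖ ^ 2 -
      ‖∑ m ∈ Finset.range L₁, (fourier (-(m : ℤ)) s : ℂ)‖ ^ 2) / ((L₂ : ℝ) - L₁)| with hF
  have hFc : Continuous F := (((continuous_fejer L₂).sub (continuous_fejer L₁)).div_const _).abs
  set f : ℝ → ℝ := fun x => F (x : UnitAddCircle) with hf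
  have hT : ∫ s, F s = ∫ x in (-(1 / 2 : ℝ))..(1 / 2), f x := by
    rw [← AddCircle.intervalIntegral_preimage 1 (-(1 / 2)) F, show (-(1 / 2 : ℝ)) + 1 = 1 / 2 by norm_num]
  have hfc : Continuous f := hFc.comp (AddCircle.continuous_mk' (1 : ℝ))
  have heven : ∀ x : ℝ, f (-x) = f x := by
    intro x
    simp only [hf, hF, AddCircle.coe_neg, norm_geomSum_neg]
  have hsplit : ∫ x in (-(1 / 2 : ℝ))..(1 / 2), f x = (∫ x in (-(1 / 2 : ℝ))..0, f x) + ∫ x in (0 : ℝ)..(1 / 2), f x :=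
    (intervalIntegral.integral_add_adjacent_intervals (hfc.intervalIntegrable _ _) (hfc.intervalIntegrable _ _)).symm
  have hleft : ∫ x in (-(1 / 2 : ℝ))..0, f x = ∫ x in (0 : ℝ)..(1 / 2), f x := by
    have h := intervalIntegral.integral_comp_neg (a := 0) (b := 1 / 2) f
    simp_rw [heven] at h
    rw [neg_zero] at h
    exact h.symm
  have hhalf : ∫ x in (0 : ℝ)..(1 / 2), f x ≤ 2 / π + 1 / π * Real.log (((L₁ : ℝ) + L₂) / ((L₂ : ℝ) - L₁)) +
      1 / (2 * ((L₂ : ℝ) - L₁)) + 1 / (2 * π * ((L₂ : ℝ) - L₁) ^ 2) := intervalIntegral_abs_trapezoidKernel_le hL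
  have hπ := Real.pi_pos
  have e : 4 / π + 2 / π * Real.log (((L₁ : ℝ) + L₂) / ((L₂ : ℝ) - L₁)) + 1 / ((L₂ : ℝ) - L₁) +
      1 / (π * ((L₂ : ℝ) - L₁) ^ 2) = 2 * (2 / π + 1 / π * Real.log (((L₁ : ℝ) + L₂) / ((L₂ : ℝ) - L₁)) +
        1 / (2 * ((L₂ : ℝ) - L₁)) + 1 / (2 * π * ((L₂ : ℝ) - L₁) ^ 2)) := by
    field_simp; ring
  calc ∫ s, F s = ∫ x in (-(1 / 2 : ℝ))..(1 / 2), f x := hT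
    _ = 2 * ∫ x in (0 : ℝ)..(1 / 2), f x := by rw [hsplit, hleft]; ring
    _ ≤ _ := by rw [e]; linarith

/-! ## §3 The `τ/δ` tail socket of the modular half-step (`…HalfStepVT/HT`) -/

/-- **Tail socket, all radii**: for EVERY `δ > 0`, `∫_{δ ≤ ‖s‖} |k_χ| ≤ (1/(2D))/δ`, `D = L₂ − L₁` — the hypothesis
`hτ : ∀ δ > 0, ∫_{δ≤‖s‖}|k_ψ| ≤ τ/δ` of the modular half-step with `τ = 1/(2D)` (for `δ ≤ ½` this is
`…TrapezoidTail.setIntegral_norm_trapezoidKernel_le_sharp` minus its `−1/D`; for `δ > ½` the annulus is empty). [cite: Grafakos2014, §3.1.3] -/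
theorem setIntegral_norm_trapezoidKernel_le_div (hL : L₁ < L₂)
    (hχ : ∀ m : ℤ, χ m = ((min 1 (max 0 (((L₂ : ℝ) - |(m : ℝ)|) / ((L₂ : ℝ) - L₁))) : ℝ) : ℂ)) {δ : ℝ} (hδ : 0 < δ) :
    ∫ s in {s : UnitAddCircle | δ ≤ ‖s‖}, ‖∑ m ∈ Finset.Icc (-(L₂ : ℤ)) L₂, χ m * fourier (-m) s‖ ≤
      1 / (2 * ((L₂ : ℝ) - L₁)) / δ := by
  have hL' : (L₁ : ℝ) < L₂ := by exact_mod_cast hL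
  have hD : (0 : ℝ) < (L₂ : ℝ) - L₁ := by linarith
  rcases le_or_gt δ (1 / 2) with hδ' | hδ'
  · have hA : MeasurableSet {s : UnitAddCircle | δ ≤ ‖s‖} := (isClosed_le continuous_const continuous_norm).measurableSet
    refine (setIntegral_norm_trapezoidKernel_le_sharp hL hχ hδ hδ' hA fun s hs => hs).trans ?_
    rw [div_div]
    have : 0 < 1 / ((L₂ : ℝ) - L₁) := by positivity
    linarith
  · -- the annulus is empty: `‖s‖ ≤ ½ < δ`
    have hempty : {s : UnitAddCircle | δ ≤ ‖s‖} = ∅ := by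
      ext s
      simp only [mem_setOf_eq, mem_empty_iff_false, iff_false, not_le]
      have h := AddCircle.norm_le_half_period (1 : ℝ) (x := s) one_ne_zero
      rw [abs_one] at h
      linarith
    rw [hempty, Measure.restrict_empty, integral_zero_measure]
    positivity

end Trapezoid

end Summit.AnomalousDissipation.AnomalousDissipation.Theorems.SawtoothPulseCascade.K1Window
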